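import Literature.MathematicalPhysics.QuantumLattice.HalfBathtubCornerBound
import HarnessLib

/-!
# Second-order kernel UPPER bounds on the half-bathtub integral `B(t', ν)` (trapezoid majorant on interior cells)

Family `hubbard` (topic `MathematicalPhysics/QuantumLattice`; companion of `HalfBathtubCornerBound` (the first-order four-corner
majorant, §8–§9 there) and of the table `HalfBathtubPairTable512`). Written for the D-0154 (1)(C) COVERAGE cell (Hg-1201 boxes
`boxHg1201E_M19b` / `_M19` / `_M19P10`; seat hubbard-cov-hg1201-unc-2 g4, 2026-08-28): the first-order corner majorant of

  `B(t', ν) = (4π²)⁻¹ ∫_{-π}^{π}∫_{-π}^{π} (cos x + cos y + 4t' cos x cos y - ν)⁺ dx dy`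

has slack `≈ 2·10⁻³` at `M = 512`, which keeps the state-free kinematic cuts of the residual patch `≈ 1/100` (in `t'`) and
`≈ 1/50` (in `n`) away from the exact kinematic frontier. This file proves a SECOND-ORDER majorant on the SAME cosine tables:
on every grid cell on which the table certifies that the symbol stays above the level (`interior` cell: the four corner values
of the bilinear symbol over the cell's cosine box are `≥ ν`), the integrand is the smooth function `s - ν` and the tensor
TRAPEZOID rule with the rigorous remainder `(1 + 4|t'|)·h⁴/6` (`h = π/M`; from the one-dimensional bound
`|sin(a+h) - sin a - (h/2)(cos a + cos(a+h))| ≤ h³/12`, §2) bounds the cell integral by the four VERTEX values; on every other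
cell the four-corner bound of `HalfBathtubCornerBound` §8 is kept. Slack at `M = 512`: `≈ 2·10⁻⁵` (e.g. `B(-27/50, 3863/8192)`:
exact `0.3031994`, first order `0.3052646`, second order `0.3032205`).

* §1 the quarter-angle cosine table check (re-proved; private upstream);
* §2 the one-dimensional trapezoid inequality for `A cos x + B` (`trapezoid_affineCos_le`);
* §3 bilinear forms on a box are between their extreme corner values; cosine bounds on the cells of `[0, π]`;
* §4 the two cell majorants (four-corner / trapezoid) and the reduction `∫_{-π}^{π}∫_{-π}^{π} = 4∫_0^π∫_0^π`;
* §5 **`halfBathtubIntegral_le_trapezoidSum`** (real form, any `t'`, any selector of interior cells certified by the lower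
  corner values) and **`halfBathtub_le_of_trapezoidTable`** — the INTEGER adapter: `B(a/b, c/E) ≤ q` from a list of
  integer quadruples `(Uᵢ, Wᵢ, U⁺ᵢ, W⁺ᵢ)` (`Uᵢ/D ≥ cos(iπ/M)` by the quarter-angle check, `Wᵢ = -U_{M-1-i}` the reflected
  lower bound of the cell, `U⁺ᵢ = Uᵢ + Uᵢ₊₁`, `W⁺ᵢ = Wᵢ₋₁ + Wᵢ` the vertex-sum bounds with the exact end values `cos 0 = 1`,
  `cos π = -1`), one decidable cell sum `≤ W` (the cell term is written out inline — an `if`/`max` integer term, evaluated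
  by `decide` in the row files exactly like the four-corner term of the first-order rows) and `W ≤ 4q·M²D²bE`.

Everything is PROVED (standard axioms); no definition, no named fact.
HONEST FRAMING: one-body kinematics; upper bounds on an explicit integral; nothing here bears on superconductivity by itself.

## Mathlib / tree search

REUSED: `Real.sin_ge_sub_cube`, `Real.cos_two_mul`, `Real.cos_sq'`, `Real.cos_le_cos_of_nonneg_of_le_pi`, `Real.pi_gt_d6`,
`Real.pi_lt_d4`, `HasDerivAt.sin/.cos`, `monotoneOn_of_deriv_nonneg`, `integral_cos`, `intervalIntegral.integral_mono_on`,
`intervalIntegral.sum_integral_adjacent_intervals`, `intervalIntegral.integral_finset_sum`, `intervalIntegral.integral_comp_neg`,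
`intervalIntegral.continuous_parametric_intervalIntegral_of_continuous'`. Mathlib's `trapezoidal_error_le` (general `C²`
integrands) is not used: for `A cos x + B` the remainder is the elementary §2 inequality. `lean search 'halfBathtub'`: the
first-order adapters `halfBathtub_le_of_cornerIntTable` / `halfBathtub_le_of_cornerPairTable` (this file is their second-order twin).

## References

* T. Hazra, N. Verma, M. Randeria, PRX 9 (2019) 031049, eqs. (2)–(6) (the bathtub bar bounding the stiffness).
  [cite: HazraVermaRanderia2019, eqs. (2)-(6)]
* P. J. Davis, P. Rabinowitz, *Methods of Numerical Integration*, 2nd ed. (1984), §2.1 (trapezoidal rule and its error),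
  §4.3 (product rules). [cite: DavisRabinowitz1984, §2.1]
* W. Rudin, *Principles of Mathematical Analysis*, 3rd ed. (1976), Thm 6.12 (b),(c) (monotonicity/additivity of the integral).
  [cite: Rudin1976, Thm 6.12]
-/

namespace Literature.MathematicalPhysics.QuantumLattice

open Real Set MeasureTheory

section HalfBathtubTrapezoidBound

/-! ### §1 The quarter-angle cosine bound and the table check (re-proved; private in `HalfBathtubCornerBound`) -/

/-- `cos θ ≤ 2(2(1 - 2(y₀ - y₀³/6)²)² - 1)² - 1` for `0 ≤ θ ≤ π`, `0 ≤ y₀ ≤ θ/8` (three angle halvings over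
`sin(θ/8) ≥ y₀ - y₀³/6`). Re-proved verbatim (private upstream). [folklore] -/
private theorem cos_le_quarterAngle_boundT {θ y₀ : ℝ} (hθ0 : 0 ≤ θ) (hθπ : θ ≤ π) (hy₀ : 0 ≤ y₀)
    (hy₀θ : y₀ ≤ θ / 8) :
    Real.cos θ ≤ 2 * (2 * (1 - 2 * (y₀ - y₀ ^ 3 / 6) ^ 2) ^ 2 - 1) ^ 2 - 1 := by
  have hπ4 := Real.pi_le_four
  have hy1 : θ / 8 ≤ 1 := by linarith
  have hy₀1 : y₀ ≤ 1 := hy₀θ.trans hy1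
  have hT0 : 0 ≤ y₀ - y₀ ^ 3 / 6 := by nlinarith [mul_nonneg hy₀ hy₀, pow_le_one₀ hy₀ hy₀1 (n := 2)]
  have hTle : y₀ - y₀ ^ 3 / 6 ≤ Real.sin (θ / 8) := by
    have h1 : y₀ - y₀ ^ 3 / 6 ≤ θ / 8 - (θ / 8) ^ 3 / 6 := by
      have hprod : 0 ≤ (θ / 8 - y₀) * (6 - ((θ / 8) ^ 2 + θ / 8 * y₀ + y₀ ^ 2)) := by
        apply mul_nonneg (by linarith)
        nlinarith [mul_nonneg hy₀ hy₀, mul_nonneg hθ0 hθ0, mul_nonneg hy₀ hθ0]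
      nlinarith [hprod]
    exact h1.trans (Real.sin_ge_sub_cube (by positivity))
  have hc4 : Real.cos (θ / 4) ≤ 1 - 2 * (y₀ - y₀ ^ 3 / 6) ^ 2 := by
    have h : Real.cos (θ / 4) = 1 - 2 * Real.sin (θ / 8) ^ 2 := by
      have h2 := Real.cos_two_mul (θ / 8)
      rw [show 2 * (θ / 8) = θ / 4 by ring] at h2
      rw [h2, Real.cos_sq']
      ring
    rw [h]
    have hsin_sq : (y₀ - y₀ ^ 3 / 6) ^ 2 ≤ Real.sin (θ / 8) ^ 2 := pow_le_pow_left₀ hT0 hTle 2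
    linarith
  have hc4nn : 0 ≤ Real.cos (θ / 4) :=
    Real.cos_nonneg_of_mem_Icc ⟨by linarith [Real.pi_pos], by linarith [Real.pi_pos]⟩
  have hc2 : Real.cos (θ / 2) ≤ 2 * (1 - 2 * (y₀ - y₀ ^ 3 / 6) ^ 2) ^ 2 - 1 := by
    have h : Real.cos (θ / 2) = 2 * Real.cos (θ / 4) ^ 2 - 1 := by
      have h2 := Real.cos_two_mul (θ / 4)
      rw [show 2 * (θ / 4) = θ / 2 by ring] at h2
      exact h2
    rw [h]
    have h' := pow_le_pow_left₀ hc4nn hc4 2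
    linarith
  have hc2nn : 0 ≤ Real.cos (θ / 2) :=
    Real.cos_nonneg_of_mem_Icc ⟨by linarith [Real.pi_pos], by linarith [Real.pi_pos]⟩
  have h : Real.cos θ = 2 * Real.cos (θ / 2) ^ 2 - 1 := by
    have h2 := Real.cos_two_mul (θ / 2)
    rw [show 2 * (θ / 2) = θ by ring] at h2
    exact h2
  rw [h]
  have h' := pow_le_pow_left₀ hc2nn hc2 2
  linarith

/-- Certified cosine tables: rationals `uq i` passing the decidable quarter-angle check satisfy `cos(iπ/M) ≤ uq i`
(`i < M`; `3.141592 < π`). Re-proved (private upstream). [folklore] -/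
private theorem cos_table_of_quarterAngle_checkT {M : ℕ} (hM : 0 < M) (uq : ℕ → ℚ)
    (h : ∀ i : ℕ, i < M → 2 * (2 * (1 - 2 * ((i : ℚ) * (392699 / 125000) / (8 * M) -
      ((i : ℚ) * (392699 / 125000) / (8 * M)) ^ 3 / 6) ^ 2) ^ 2 - 1) ^ 2 - 1 ≤ uq i) :
    ∀ i < M, Real.cos (i * π / M) ≤ ((uq i : ℚ) : ℝ) := by
  intro i hi
  have hMr : (0 : ℝ) < M := by exact_mod_cast hM
  have hπ := Real.pi_pos
  have hθ0 : 0 ≤ (i : ℝ) * π / M := by positivity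
  have hθπ : (i : ℝ) * π / M ≤ π := by
    rw [div_le_iff₀ hMr]
    have h' : (i : ℝ) ≤ M := by exact_mod_cast hi.le
    nlinarith
  have hy₀ : 0 ≤ (i : ℝ) * (392699 / 125000) / (8 * M) := by positivity
  have hy₀θ : (i : ℝ) * (392699 / 125000) / (8 * M) ≤ (i : ℝ) * π / M / 8 := by
    have hpi : (392699 / 125000 : ℝ) ≤ π := by
      have h6 := Real.pi_gt_d6
      norm_num at h6 ⊢
      linarith
    have h1 : (i : ℝ) * (392699 / 125000) ≤ (i : ℝ) * π :=
      mul_le_mul_of_nonneg_left hpi (Nat.cast_nonneg i)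
    calc (i : ℝ) * (392699 / 125000) / (8 * M) ≤ (i : ℝ) * π / (8 * M) := by gcongr
      _ = (i : ℝ) * π / M / 8 := by ring
  have key := cos_le_quarterAngle_boundT hθ0 hθπ hy₀ hy₀θ
  have hq : ((2 * (2 * (1 - 2 * ((i : ℚ) * (392699 / 125000) / (8 * M) -
      ((i : ℚ) * (392699 / 125000) / (8 * M)) ^ 3 / 6) ^ 2) ^ 2 - 1) ^ 2 - 1 : ℚ) : ℝ) ≤
      ((uq i : ℚ) : ℝ) := by exact_mod_cast h i hi
  refine key.trans (le_of_eq_of_le ?_ hq)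
  push_cast
  ring

/-! ### §2 The one-dimensional trapezoid inequality for `A cos x + B` -/

/-- For `|ε| ≤ 1`, every `a` and `h ≥ 0`: `0 ≤ h³/12 - ε·(sin(a+h) - sin a - (h/2)(cos a + cos(a+h)))` — the function of `h`
vanishes with its first derivative at `0` and has second derivative `(h/2)(1 - ε cos(a+h)) ≥ 0`. [cite: DavisRabinowitz1984, §2.1] -/
private theorem trapezoid_aux {ε : ℝ} (hε : |ε| ≤ 1) (a : ℝ) {h : ℝ} (hh : 0 ≤ h) :
    0 ≤ h ^ 3 / 12 - ε * (Real.sin (a + h) - Real.sin a - h / 2 * (Real.cos a + Real.cos (a + h))) := by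
  -- first derivative
  have hd1 : ∀ x, HasDerivAt
      (fun h : ℝ => h ^ 3 / 12 - ε * (Real.sin (a + h) - Real.sin a - h / 2 * (Real.cos a + Real.cos (a + h))))
      (x ^ 2 / 4 - ε * ((Real.cos (a + x) - Real.cos a) / 2 + x / 2 * Real.sin (a + x))) x := by
    intro x
    have hs : HasDerivAt (fun x => Real.sin (a + x)) (Real.cos (a + x) * 1) x :=
      ((hasDerivAt_id' x).const_add a).sin
    have hc : HasDerivAt (fun x => Real.cos (a + x)) (-Real.sin (a + x) * 1) x :=
      ((hasDerivAt_id' x).const_add a).cos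
    have h3 : HasDerivAt (fun x : ℝ => x ^ 3 / 12) ((3 : ℕ) * x ^ (3 - 1) / 12) x :=
      (hasDerivAt_pow 3 x).div_const 12
    have hl : HasDerivAt (fun x : ℝ => x / 2) (1 / 2) x := (hasDerivAt_id' x).div_const 2
    have hall := h3.sub (((hs.sub_const (Real.sin a)).sub (hl.mul (hc.const_add (Real.cos a)))).const_mul ε)
    refine hall.congr_deriv ?_
    push_cast
    ring
  -- second derivative
  have hd2 : ∀ x, HasDerivAt
      (fun h : ℝ => h ^ 2 / 4 - ε * ((Real.cos (a + h) - Real.cos a) / 2 + h / 2 * Real.sin (a + h)))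
      (x / 2 * (1 - ε * Real.cos (a + x))) x := by
    intro x
    have hs : HasDerivAt (fun x => Real.sin (a + x)) (Real.cos (a + x) * 1) x :=
      ((hasDerivAt_id' x).const_add a).sin
    have hc : HasDerivAt (fun x => Real.cos (a + x)) (-Real.sin (a + x) * 1) x :=
      ((hasDerivAt_id' x).const_add a).cos
    have h2 : HasDerivAt (fun x : ℝ => x ^ 2 / 4) ((2 : ℕ) * x ^ (2 - 1) / 4) x :=
      (hasDerivAt_pow 2 x).div_const 4
    have hl : HasDerivAt (fun x : ℝ => x / 2) (1 / 2) x := (hasDerivAt_id' x).div_const 2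
    have hall := h2.sub ((((hc.sub_const (Real.cos a)).div_const 2).add (hl.mul hs)).const_mul ε)
    refine hall.congr_deriv ?_
    push_cast
    ring
  have hΦ''nn : ∀ x : ℝ, 0 ≤ x → 0 ≤ x / 2 * (1 - ε * Real.cos (a + x)) := by
    intro x hx
    have h1 : ε * Real.cos (a + x) ≤ 1 := by
      have habs : |ε * Real.cos (a + x)| ≤ 1 := by
        rw [abs_mul]
        calc |ε| * |Real.cos (a + x)| ≤ 1 * 1 :=
              mul_le_mul hε (Real.abs_cos_le_one _) (abs_nonneg _) zero_le_one
          _ = 1 := one_mul 1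
      exact (le_abs_self _).trans habs
    exact mul_nonneg (by linarith) (by linarith)
  -- the first derivative is monotone on `[0, ∞)`, hence non-negative there
  have hmono' : MonotoneOn
      (fun h : ℝ => h ^ 2 / 4 - ε * ((Real.cos (a + h) - Real.cos a) / 2 + h / 2 * Real.sin (a + h))) (Ici 0) := by
    refine monotoneOn_of_deriv_nonneg (convex_Ici 0) ?_ ?_ ?_
    · exact HasDerivAt.continuousOn fun x _ => hd2 x
    · exact fun x _ => (hd2 x).differentiableAt.differentiableWithinAt
    · intro x hx
      rw [interior_Ici] at hx
      rw [(hd2 x).deriv]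
      exact hΦ''nn x (le_of_lt hx)
  have hΦ'nn : ∀ x : ℝ, 0 ≤ x →
      0 ≤ x ^ 2 / 4 - ε * ((Real.cos (a + x) - Real.cos a) / 2 + x / 2 * Real.sin (a + x)) := by
    intro x hx
    have h := hmono' (self_mem_Ici (a := (0 : ℝ))) (mem_Ici.2 hx) hx
    simp only at h
    have e : (0 : ℝ) ^ 2 / 4 - ε * ((Real.cos (a + 0) - Real.cos a) / 2 + 0 / 2 * Real.sin (a + 0)) = 0 := by
      simp
    linarith [h, e]
  have hmono : MonotoneOn
      (fun h : ℝ => h ^ 3 / 12 - ε * (Real.sin (a + h) - Real.sin a - h / 2 * (Real.cos a + Real.cos (a + h))))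
      (Ici 0) := by
    refine monotoneOn_of_deriv_nonneg (convex_Ici 0) ?_ ?_ ?_
    · exact HasDerivAt.continuousOn fun x _ => hd1 x
    · exact fun x _ => (hd1 x).differentiableAt.differentiableWithinAt
    · intro x hx
      rw [interior_Ici] at hx
      rw [(hd1 x).deriv]
      exact hΦ'nn x (le_of_lt hx)
  have h := hmono (self_mem_Ici (a := (0 : ℝ))) (mem_Ici.2 hh) hh
  simp only at h
  have e : (0 : ℝ) ^ 3 / 12 - ε * (Real.sin (a + 0) - Real.sin a - 0 / 2 * (Real.cos a + Real.cos (a + 0))) = 0 := by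
    simp
  linarith [h, e]

/-- **The trapezoid inequality for `A cos x + B` on `[a, a+h]`** (`h ≥ 0`):
`∫_a^{a+h} (A cos x + B) dx ≤ (h/2)·((A cos a + B) + (A cos(a+h) + B)) + |A|·h³/12`
(exact integral `A(sin(a+h) - sin a) + Bh` and `|sin(a+h) - sin a - (h/2)(cos a + cos(a+h))| ≤ h³/12`).
[cite: DavisRabinowitz1984, §2.1] -/
theorem trapezoid_affineCos_le (A B a : ℝ) {h : ℝ} (hh : 0 ≤ h) :
    ∫ x in a..a + h, (A * Real.cos x + B) ≤
      h / 2 * ((A * Real.cos a + B) + (A * Real.cos (a + h) + B)) + |A| * h ^ 3 / 12 := by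
  have hI : ∫ x in a..a + h, (A * Real.cos x + B) =
      (A * Real.sin (a + h) + B * (a + h)) - (A * Real.sin a + B * a) := by
    have hFTC := intervalIntegral.integral_eq_sub_of_hasDerivAt (f := fun x => A * Real.sin x + B * x)
      (f' := fun x => A * Real.cos x + B) (a := a) (b := a + h)
      (fun x _ => by
        have h1 := ((Real.hasDerivAt_sin x).const_mul A).add ((hasDerivAt_id' x).const_mul B)
        exact h1.congr_deriv (by simp))
      ((by fun_prop : Continuous fun x => A * Real.cos x + B).intervalIntegrable _ _)
    simpa only using hFTC
  rw [hI]
  have key : |Real.sin (a + h) - Real.sin a - h / 2 * (Real.cos a + Real.cos (a + h))| ≤ h ^ 3 / 12 := by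
    rw [abs_le]
    constructor
    · have h1 := trapezoid_aux (ε := -1) (by norm_num) a hh
      linarith
    · have h1 := trapezoid_aux (ε := 1) (by norm_num) a hh
      linarith
  have hA : A * (Real.sin (a + h) - Real.sin a - h / 2 * (Real.cos a + Real.cos (a + h))) ≤ |A| * (h ^ 3 / 12) :=
    calc A * (Real.sin (a + h) - Real.sin a - h / 2 * (Real.cos a + Real.cos (a + h)))
        ≤ |A * (Real.sin (a + h) - Real.sin a - h / 2 * (Real.cos a + Real.cos (a + h)))| := le_abs_self _
      _ = |A| * |Real.sin (a + h) - Real.sin a - h / 2 * (Real.cos a + Real.cos (a + h))| := abs_mul _ _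
      _ ≤ |A| * (h ^ 3 / 12) := mul_le_mul_of_nonneg_left key (abs_nonneg A)
  have e : h / 2 * ((A * Real.cos a + B) + (A * Real.cos (a + h) + B)) + |A| * h ^ 3 / 12 -
      ((A * Real.sin (a + h) + B * (a + h)) - (A * Real.sin a + B * a)) =
      |A| * (h ^ 3 / 12) - A * (Real.sin (a + h) - Real.sin a - h / 2 * (Real.cos a + Real.cos (a + h))) := by
    ring
  rw [← sub_nonneg, e]
  linarith

/-! ### §3 Bilinear forms on a box; the cosine on the cells of `[0, π]` -/

/-- An affine function on an interval lies between its end values. [folklore] -/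
private theorem affine_mem_endpoints (p q : ℝ) {s s₁ s₂ : ℝ} (h1 : s₁ ≤ s) (h2 : s ≤ s₂) :
    min (p * s₁ + q) (p * s₂ + q) ≤ p * s + q ∧ p * s + q ≤ max (p * s₁ + q) (p * s₂ + q) := by
  rcases le_or_gt 0 p with hp | hp
  · exact ⟨min_le_of_left_le (by nlinarith), le_max_of_le_right (by nlinarith)⟩
  · exact ⟨min_le_of_right_le (by nlinarith), le_max_of_le_left (by nlinarith)⟩

/-- **A bilinear form on a box lies between its extreme corner values**: for `loA ≤ a ≤ hiA`, `loB ≤ b ≤ hiB` and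
`F(p, q) = αp + βq + γpq + δ`, `min₄ F(corners) ≤ F(a, b) ≤ max₄ F(corners)` (affine in each variable separately).
[folklore] -/
private theorem bilin_mem_corners (α β γ δ : ℝ) {a b loA hiA loB hiB : ℝ}
    (ha1 : loA ≤ a) (ha2 : a ≤ hiA) (hb1 : loB ≤ b) (hb2 : b ≤ hiB) :
    min (min (α * loA + β * loB + γ * (loA * loB) + δ) (α * loA + β * hiB + γ * (loA * hiB) + δ))
        (min (α * hiA + β * loB + γ * (hiA * loB) + δ) (α * hiA + β * hiB + γ * (hiA * hiB) + δ)) ≤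
      α * a + β * b + γ * (a * b) + δ ∧
    α * a + β * b + γ * (a * b) + δ ≤
      max (max (α * loA + β * loB + γ * (loA * loB) + δ) (α * loA + β * hiB + γ * (loA * hiB) + δ))
        (max (α * hiA + β * loB + γ * (hiA * loB) + δ) (α * hiA + β * hiB + γ * (hiA * hiB) + δ)) := by
  -- affine in `a` at fixed `b`
  have hA := affine_mem_endpoints (α + γ * b) (β * b + δ) ha1 ha2
  have eA : ∀ A : ℝ, (α + γ * b) * A + (β * b + δ) = α * A + β * b + γ * (A * b) + δ := fun A => by ring
  rw [eA, eA, eA] at hA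
  -- affine in `b` at the two end values of `a`
  have hB : ∀ A : ℝ,
      min (α * A + β * loB + γ * (A * loB) + δ) (α * A + β * hiB + γ * (A * hiB) + δ) ≤
        α * A + β * b + γ * (A * b) + δ ∧
      α * A + β * b + γ * (A * b) + δ ≤
        max (α * A + β * loB + γ * (A * loB) + δ) (α * A + β * hiB + γ * (A * hiB) + δ) := by
    intro A
    have h := affine_mem_endpoints (β + γ * A) (α * A + δ) hb1 hb2
    have eB : ∀ B : ℝ, (β + γ * A) * B + (α * A + δ) = α * A + β * B + γ * (A * B) + δ := fun B => by ring
    rw [eB, eB, eB] at h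
    exact h
  exact ⟨(min_le_min (hB loA).1 (hB hiA).1).trans hA.1, hA.2.trans (max_le_max (hB loA).2 (hB hiA).2)⟩

/-- On the cell `iπ/M ≤ x ≤ (i+1)π/M` of `[0, π]` (`i < M`) the cosine lies between its end values:
`cos((i+1)π/M) ≤ cos x ≤ cos(iπ/M)`. [folklore] -/
private theorem cos_mem_cell {M : ℕ} (hM : 0 < M) {i : ℕ} (hi : i < M) {x : ℝ}
    (hx1 : (i : ℝ) * (π / M) ≤ x) (hx2 : x ≤ (i : ℝ) * (π / M) + π / M) :
    Real.cos ((i : ℝ) * (π / M) + π / M) ≤ Real.cos x ∧ Real.cos x ≤ Real.cos ((i : ℝ) * (π / M)) := by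
  have hMr : (0 : ℝ) < M := by exact_mod_cast hM
  have hπ := Real.pi_pos
  have h0 : 0 ≤ (i : ℝ) * (π / M) := by positivity
  have hle : (i : ℝ) * (π / M) + π / M ≤ π := by
    have h : (i : ℝ) + 1 ≤ M := by exact_mod_cast hi
    have e : (i : ℝ) * (π / M) + π / M = ((i : ℝ) + 1) * π / M := by ring
    rw [e, div_le_iff₀ hMr]
    nlinarith
  exact ⟨Real.cos_le_cos_of_nonneg_of_le_pi (h0.trans hx1) hle hx2,
    Real.cos_le_cos_of_nonneg_of_le_pi h0 (hx2.trans hle) hx1⟩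

/-! ### §4 The two cell majorants and the reduction to `[0, π]²` -/

/-- **Four-corner cell majorant.** On a cell `[θ₁, θ₁+h] × [φ₁, φ₁+h]` with cosine boxes `[loA, hiA]`, `[loB, hiB]`,
`∫∫_cell (cos x + cos y + 4t' cos x cos y - ν)⁺ ≤ h²·max₄⁺` (the corner values of the bilinear symbol on the box;
`HalfBathtubCornerBound` §8 cell by cell). [cite: HazraVermaRanderia2019, eqs. (2)-(6)] -/
private theorem cell_le_corner (t' ν : ℝ) {θ₁ φ₁ h : ℝ} (hh : 0 ≤ h) {loA hiA loB hiB : ℝ}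
    (hA : ∀ x ∈ Icc θ₁ (θ₁ + h), loA ≤ Real.cos x ∧ Real.cos x ≤ hiA)
    (hB : ∀ y ∈ Icc φ₁ (φ₁ + h), loB ≤ Real.cos y ∧ Real.cos y ≤ hiB) :
    (∫ y in φ₁..φ₁ + h, ∫ x in θ₁..θ₁ + h,
        max (Real.cos x + Real.cos y + 4 * t' * (Real.cos x * Real.cos y) - ν) 0) ≤
      h ^ 2 * max (max (max (loA + loB + 4 * t' * (loA * loB) - ν) (loA + hiB + 4 * t' * (loA * hiB) - ν))
        (max (hiA + loB + 4 * t' * (hiA * loB) - ν) (hiA + hiB + 4 * t' * (hiA * hiB) - ν))) 0 := by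
  set C := max (max (max (loA + loB + 4 * t' * (loA * loB) - ν) (loA + hiB + 4 * t' * (loA * hiB) - ν))
        (max (hiA + loB + 4 * t' * (hiA * loB) - ν) (hiA + hiB + 4 * t' * (hiA * hiB) - ν))) 0 with hC
  have hgc : Continuous (Function.uncurry fun y x : ℝ =>
      max (Real.cos x + Real.cos y + 4 * t' * (Real.cos x * Real.cos y) - ν) 0) := by
    rw [Function.uncurry_def]
    fun_prop
  have hθ : θ₁ ≤ θ₁ + h := by linarith
  have hφ : φ₁ ≤ φ₁ + h := by linarith
  -- pointwise bound on the cell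
  have hpt : ∀ y ∈ Icc φ₁ (φ₁ + h), ∀ x ∈ Icc θ₁ (θ₁ + h),
      max (Real.cos x + Real.cos y + 4 * t' * (Real.cos x * Real.cos y) - ν) 0 ≤ C := by
    intro y hy x hx
    have h4 := (bilin_mem_corners 1 1 (4 * t') (-ν) (hA x hx).1 (hA x hx).2 (hB y hy).1 (hB y hy).2).2
    have e : ∀ p q : ℝ, 1 * p + 1 * q + 4 * t' * (p * q) + -ν = p + q + 4 * t' * (p * q) - ν := fun p q => by ring
    simp only [e] at h4
    exact max_le_max_right 0 h4
  -- inner integrals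
  have hinner : ∀ y ∈ Icc φ₁ (φ₁ + h),
      (∫ x in θ₁..θ₁ + h, max (Real.cos x + Real.cos y + 4 * t' * (Real.cos x * Real.cos y) - ν) 0) ≤ h * C := by
    intro y hy
    have hcx : Continuous fun x => max (Real.cos x + Real.cos y + 4 * t' * (Real.cos x * Real.cos y) - ν) 0 := by
      fun_prop
    calc (∫ x in θ₁..θ₁ + h, max (Real.cos x + Real.cos y + 4 * t' * (Real.cos x * Real.cos y) - ν) 0)
        ≤ ∫ _ in θ₁..θ₁ + h, C :=
          intervalIntegral.integral_mono_on hθ (hcx.intervalIntegrable _ _) intervalIntegrable_const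
            fun x hx => hpt y hy x hx
      _ = h * C := by rw [intervalIntegral.integral_const, smul_eq_mul]; ring
  have hF : Continuous fun y => ∫ x in θ₁..θ₁ + h,
      max (Real.cos x + Real.cos y + 4 * t' * (Real.cos x * Real.cos y) - ν) 0 :=
    intervalIntegral.continuous_parametric_intervalIntegral_of_continuous' hgc θ₁ (θ₁ + h)
  calc (∫ y in φ₁..φ₁ + h, ∫ x in θ₁..θ₁ + h,
        max (Real.cos x + Real.cos y + 4 * t' * (Real.cos x * Real.cos y) - ν) 0)
      ≤ ∫ _ in φ₁..φ₁ + h, h * C :=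
        intervalIntegral.integral_mono_on hφ (hF.intervalIntegrable _ _) intervalIntegrable_const
          fun y hy => hinner y hy
    _ = h ^ 2 * C := by rw [intervalIntegral.integral_const, smul_eq_mul]; ring

/-- **Trapezoid cell majorant (interior cells).** On a cell `[θ₁, θ₁+h] × [φ₁, φ₁+h]` with cosine boxes `[loA, hiA]`,
`[loB, hiB]` on which the four corner values of `p + q + 4t'pq` are `≥ ν` (so the integrand IS `s - ν` on the cell), and
vertex-sum boxes `WA ≤ cos θ₁ + cos(θ₁+h) ≤ UA`, `WB ≤ cos φ₁ + cos(φ₁+h) ≤ UB`: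
`∫∫_cell (s - ν)⁺ ≤ h²·(max₄(2P + 2Q + 4t'PQ)/4 - ν) + (1 + 4|t'|)·h⁴/6` (tensor trapezoid rule, §2 twice; the four vertex
values add up to `2A + 2B + 4t'AB - 4ν` with `A`, `B` the vertex sums). [cite: DavisRabinowitz1984, §2.1] -/
private theorem cell_le_trapezoid (t' ν : ℝ) {θ₁ φ₁ h : ℝ} (hh : 0 ≤ h) {loA hiA loB hiB : ℝ}
    (hA : ∀ x ∈ Icc θ₁ (θ₁ + h), loA ≤ Real.cos x ∧ Real.cos x ≤ hiA)
    (hB : ∀ y ∈ Icc φ₁ (φ₁ + h), loB ≤ Real.cos y ∧ Real.cos y ≤ hiB)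
    (h₁ : ν ≤ loA + loB + 4 * t' * (loA * loB)) (h₂ : ν ≤ loA + hiB + 4 * t' * (loA * hiB))
    (h₃ : ν ≤ hiA + loB + 4 * t' * (hiA * loB)) (h₄ : ν ≤ hiA + hiB + 4 * t' * (hiA * hiB))
    {WA UA WB UB : ℝ}
    (hWA : WA ≤ Real.cos θ₁ + Real.cos (θ₁ + h)) (hUA : Real.cos θ₁ + Real.cos (θ₁ + h) ≤ UA)
    (hWB : WB ≤ Real.cos φ₁ + Real.cos (φ₁ + h)) (hUB : Real.cos φ₁ + Real.cos (φ₁ + h) ≤ UB) :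
    (∫ y in φ₁..φ₁ + h, ∫ x in θ₁..θ₁ + h,
        max (Real.cos x + Real.cos y + 4 * t' * (Real.cos x * Real.cos y) - ν) 0) ≤
      h ^ 2 * (max (max (2 * WA + 2 * WB + 4 * t' * (WA * WB)) (2 * WA + 2 * UB + 4 * t' * (WA * UB)))
        (max (2 * UA + 2 * WB + 4 * t' * (UA * WB)) (2 * UA + 2 * UB + 4 * t' * (UA * UB))) / 4 - ν) +
        (1 + 4 * |t'|) * h ^ 4 / 6 := by
  have hgc : Continuous (Function.uncurry fun y x : ℝ =>
      max (Real.cos x + Real.cos y + 4 * t' * (Real.cos x * Real.cos y) - ν) 0) := by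
    rw [Function.uncurry_def]
    fun_prop
  have hθ : θ₁ ≤ θ₁ + h := by linarith
  have hφ : φ₁ ≤ φ₁ + h := by linarith
  -- on the cell the symbol is above the level
  have hge : ∀ y ∈ Icc φ₁ (φ₁ + h), ∀ x ∈ Icc θ₁ (θ₁ + h),
      ν ≤ Real.cos x + Real.cos y + 4 * t' * (Real.cos x * Real.cos y) := by
    intro y hy x hx
    have h4 := (bilin_mem_corners 1 1 (4 * t') 0 (hA x hx).1 (hA x hx).2 (hB y hy).1 (hB y hy).2).1
    have e : ∀ p q : ℝ, 1 * p + 1 * q + 4 * t' * (p * q) + 0 = p + q + 4 * t' * (p * q) := fun p q => by ring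
    simp only [e] at h4
    exact (le_min (le_min h₁ h₂) (le_min h₃ h₄)).trans h4
  -- inner integrals: the integrand is `(1 + 4t' cos y) cos x + (cos y - ν)`; trapezoid in `x`
  have hinner : ∀ y ∈ Icc φ₁ (φ₁ + h),
      (∫ x in θ₁..θ₁ + h, max (Real.cos x + Real.cos y + 4 * t' * (Real.cos x * Real.cos y) - ν) 0) ≤
        h / 2 * ((Real.cos θ₁ + Real.cos y + 4 * t' * (Real.cos θ₁ * Real.cos y) - ν) +
          (Real.cos (θ₁ + h) + Real.cos y + 4 * t' * (Real.cos (θ₁ + h) * Real.cos y) - ν)) +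
        (1 + 4 * |t'|) * h ^ 3 / 12 := by
    intro y hy
    have heq : (∫ x in θ₁..θ₁ + h, max (Real.cos x + Real.cos y + 4 * t' * (Real.cos x * Real.cos y) - ν) 0) =
        ∫ x in θ₁..θ₁ + h, ((1 + 4 * t' * Real.cos y) * Real.cos x + (Real.cos y - ν)) := by
      refine intervalIntegral.integral_congr fun x hx => ?_
      rw [uIcc_of_le hθ] at hx
      have h1 := hge y hy x hx
      rw [max_eq_left (by linarith)]
      ring
    rw [heq]
    have htr := trapezoid_affineCos_le (1 + 4 * t' * Real.cos y) (Real.cos y - ν) θ₁ hh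
    have hAabs : |1 + 4 * t' * Real.cos y| ≤ 1 + 4 * |t'| := by
      calc |1 + 4 * t' * Real.cos y| ≤ |1| + |4 * t' * Real.cos y| := abs_add_le _ _
        _ = 1 + 4 * (|t'| * |Real.cos y|) := by rw [abs_one, abs_mul, abs_mul, abs_of_pos (by norm_num : (0:ℝ) < 4), mul_assoc]
        _ ≤ 1 + 4 * (|t'| * 1) := by gcongr; exact Real.abs_cos_le_one y
        _ = 1 + 4 * |t'| := by ring
    have hrem : |1 + 4 * t' * Real.cos y| * h ^ 3 / 12 ≤ (1 + 4 * |t'|) * h ^ 3 / 12 := by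
      have h3 : 0 ≤ h ^ 3 / 12 := by positivity
      have := mul_le_mul_of_nonneg_right hAabs h3
      linarith [this]
    have e1 : h / 2 * (((1 + 4 * t' * Real.cos y) * Real.cos θ₁ + (Real.cos y - ν)) +
        ((1 + 4 * t' * Real.cos y) * Real.cos (θ₁ + h) + (Real.cos y - ν))) =
        h / 2 * ((Real.cos θ₁ + Real.cos y + 4 * t' * (Real.cos θ₁ * Real.cos y) - ν) +
          (Real.cos (θ₁ + h) + Real.cos y + 4 * t' * (Real.cos (θ₁ + h) * Real.cos y) - ν)) := by ring
    linarith [htr, hrem, e1]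
  -- outer integral: the inner bound is `A' cos y + B'`; trapezoid in `y`
  have hF : Continuous fun y => ∫ x in θ₁..θ₁ + h,
      max (Real.cos x + Real.cos y + 4 * t' * (Real.cos x * Real.cos y) - ν) 0 :=
    intervalIntegral.continuous_parametric_intervalIntegral_of_continuous' hgc θ₁ (θ₁ + h)
  set Acell := Real.cos θ₁ + Real.cos (θ₁ + h) with hAcell
  set Bcell := Real.cos φ₁ + Real.cos (φ₁ + h) with hBcell
  set A' := h / 2 * (2 + 4 * t' * Acell) with hA'
  set B' := h / 2 * (Acell - 2 * ν) + (1 + 4 * |t'|) * h ^ 3 / 12 with hB'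
  have hbound_eq : ∀ y : ℝ, h / 2 * ((Real.cos θ₁ + Real.cos y + 4 * t' * (Real.cos θ₁ * Real.cos y) - ν) +
      (Real.cos (θ₁ + h) + Real.cos y + 4 * t' * (Real.cos (θ₁ + h) * Real.cos y) - ν)) +
      (1 + 4 * |t'|) * h ^ 3 / 12 = A' * Real.cos y + B' := by
    intro y
    simp only [hA', hB', hAcell]
    ring
  have hstep1 : (∫ y in φ₁..φ₁ + h, ∫ x in θ₁..θ₁ + h,
      max (Real.cos x + Real.cos y + 4 * t' * (Real.cos x * Real.cos y) - ν) 0) ≤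
      ∫ y in φ₁..φ₁ + h, (A' * Real.cos y + B') := by
    refine intervalIntegral.integral_mono_on hφ (hF.intervalIntegrable _ _)
      ((by fun_prop : Continuous fun y => A' * Real.cos y + B').intervalIntegrable _ _) fun y hy => ?_
    rw [← hbound_eq y]
    exact hinner y hy
  have hstep2 := trapezoid_affineCos_le A' B' φ₁ hh
  -- the remainder of the outer step: `|A'| ≤ h (1 + 4|t'|)`
  have hAcell_abs : |Acell| ≤ 2 := by
    simp only [hAcell]
    calc |Real.cos θ₁ + Real.cos (θ₁ + h)| ≤ |Real.cos θ₁| + |Real.cos (θ₁ + h)| := abs_add_le _ _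
      _ ≤ 1 + 1 := add_le_add (Real.abs_cos_le_one _) (Real.abs_cos_le_one _)
      _ = 2 := by norm_num
  have hA'abs : |A'| ≤ h * (1 + 4 * |t'|) := by
    simp only [hA']
    rw [abs_mul, abs_of_nonneg (by linarith : (0:ℝ) ≤ h / 2)]
    have h1 : |2 + 4 * t' * Acell| ≤ 2 + 8 * |t'| := by
      calc |2 + 4 * t' * Acell| ≤ |2| + |4 * t' * Acell| := abs_add_le _ _
        _ = 2 + 4 * (|t'| * |Acell|) := by
            rw [abs_of_pos (by norm_num : (0:ℝ) < 2), abs_mul, abs_mul, abs_of_pos (by norm_num : (0:ℝ) < 4), mul_assoc]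
        _ ≤ 2 + 4 * (|t'| * 2) := by gcongr
        _ = 2 + 8 * |t'| := by ring
    have h2 : 0 ≤ h / 2 := by linarith
    calc h / 2 * |2 + 4 * t' * Acell| ≤ h / 2 * (2 + 8 * |t'|) := mul_le_mul_of_nonneg_left h1 h2
      _ = h * (1 + 4 * |t'|) := by ring
  have hrem2 : |A'| * h ^ 3 / 12 ≤ h * (1 + 4 * |t'|) * h ^ 3 / 12 := by
    have h3 : 0 ≤ h ^ 3 / 12 := by positivity
    have := mul_le_mul_of_nonneg_right hA'abs h3
    linarith [this]
  -- the main term: the four vertex values add up to `G(Acell, Bcell) - 4ν`, `G` below its largest corner value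
  have hG := (bilin_mem_corners 2 2 (4 * t') 0 hWA hUA hWB hUB).2
  have eG : ∀ P Q : ℝ, 2 * P + 2 * Q + 4 * t' * (P * Q) + 0 = 2 * P + 2 * Q + 4 * t' * (P * Q) := fun P Q => by ring
  simp only [eG] at hG
  have hh2 : 0 ≤ h ^ 2 / 4 := by positivity
  have hmain := mul_le_mul_of_nonneg_left hG hh2
  have e2 : h / 2 * ((A' * Real.cos φ₁ + B') + (A' * Real.cos (φ₁ + h) + B')) =
      h ^ 2 / 4 * (2 * Acell + 2 * Bcell + 4 * t' * (Acell * Bcell)) - h ^ 2 * ν +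
        h * (1 + 4 * |t'|) * h ^ 3 / 12 := by
    simp only [hA', hB', hBcell]
    ring
  have e3 : h ^ 2 * (max (max (2 * WA + 2 * WB + 4 * t' * (WA * WB)) (2 * WA + 2 * UB + 4 * t' * (WA * UB)))
        (max (2 * UA + 2 * WB + 4 * t' * (UA * WB)) (2 * UA + 2 * UB + 4 * t' * (UA * UB))) / 4 - ν) +
        (1 + 4 * |t'|) * h ^ 4 / 6 =
      h ^ 2 / 4 * max (max (2 * WA + 2 * WB + 4 * t' * (WA * WB)) (2 * WA + 2 * UB + 4 * t' * (WA * UB)))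
        (max (2 * UA + 2 * WB + 4 * t' * (UA * WB)) (2 * UA + 2 * UB + 4 * t' * (UA * UB))) - h ^ 2 * ν +
        h * (1 + 4 * |t'|) * h ^ 3 / 12 + h * (1 + 4 * |t'|) * h ^ 3 / 12 := by
    ring
  rw [e3]
  linarith [hstep1, hstep2, hrem2, hmain, e2]

/-- `∫_{-π}^{π}∫_{-π}^{π} g = 4 ∫_0^π∫_0^π g` for a continuous integrand even in each variable. [cite: Rudin1976, Thm 6.12] -/
private theorem integral_sq_eq_four_mul (g : ℝ → ℝ → ℝ) (hg : Continuous (Function.uncurry g))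
    (hgx : ∀ y x, g y (-x) = g y x) (hgy : ∀ y x, g (-y) x = g y x) :
    (∫ y in (-π)..π, ∫ x in (-π)..π, g y x) = 4 * ∫ y in (0 : ℝ)..π, ∫ x in (0 : ℝ)..π, g y x := by
  have hgy_cont : ∀ y, Continuous (g y) := fun y => hg.uncurry_left y
  -- evenness in `x`
  have hx : ∀ y, (∫ x in (-π)..π, g y x) = 2 * ∫ x in (0 : ℝ)..π, g y x := by
    intro y
    have hsplit := intervalIntegral.integral_add_adjacent_intervals (μ := volume)
      ((hgy_cont y).intervalIntegrable (-π) 0) ((hgy_cont y).intervalIntegrable 0 π)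
    have hneg : (∫ x in (-π)..0, g y x) = ∫ x in (0 : ℝ)..π, g y x := by
      have h := intervalIntegral.integral_comp_neg (a := 0) (b := π) (fun x => g y x)
      simp only [neg_zero] at h
      rw [← h]
      exact intervalIntegral.integral_congr fun x _ => hgx y x
    rw [← hsplit, hneg]
    ring
  have hG : Continuous fun y => ∫ x in (0 : ℝ)..π, g y x :=
    intervalIntegral.continuous_parametric_intervalIntegral_of_continuous' hg 0 π
  have hGeven : ∀ y, (∫ x in (0 : ℝ)..π, g (-y) x) = ∫ x in (0 : ℝ)..π, g y x := fun y =>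
    intervalIntegral.integral_congr fun x _ => hgy y x
  -- evenness in `y`
  have hy : (∫ y in (-π)..π, ∫ x in (0 : ℝ)..π, g y x) = 2 * ∫ y in (0 : ℝ)..π, ∫ x in (0 : ℝ)..π, g y x := by
    have hsplit := intervalIntegral.integral_add_adjacent_intervals (μ := volume)
      (hG.intervalIntegrable (-π) 0) (hG.intervalIntegrable 0 π)
    have hneg : (∫ y in (-π)..0, ∫ x in (0 : ℝ)..π, g y x) = ∫ y in (0 : ℝ)..π, ∫ x in (0 : ℝ)..π, g y x := by
      have h := intervalIntegral.integral_comp_neg (a := 0) (b := π) (fun y => ∫ x in (0 : ℝ)..π, g y x)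
      simp only [neg_zero] at h
      rw [← h]
      exact intervalIntegral.integral_congr fun y _ => hGeven y
    rw [← hsplit, hneg]
    ring
  calc (∫ y in (-π)..π, ∫ x in (-π)..π, g y x) = ∫ y in (-π)..π, 2 * ∫ x in (0 : ℝ)..π, g y x :=
        intervalIntegral.integral_congr fun y _ => hx y
    _ = 2 * ∫ y in (-π)..π, ∫ x in (0 : ℝ)..π, g y x := intervalIntegral.integral_const_mul _ _
    _ = 4 * ∫ y in (0 : ℝ)..π, ∫ x in (0 : ℝ)..π, g y x := by rw [hy]; ring

/-- `∫_0^π∫_0^π g = Σ_{i,j<M} ∫∫_{cell (i,j)} g` on the uniform `M × M` grid (`x`-cell `i`, `y`-cell `j`).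
[cite: Rudin1976, Thm 6.12] -/
private theorem integral_sq_eq_sum_cells (g : ℝ → ℝ → ℝ) (hg : Continuous (Function.uncurry g))
    {M : ℕ} (hM : 0 < M) :
    (∫ y in (0 : ℝ)..π, ∫ x in (0 : ℝ)..π, g y x) =
      ∑ i ∈ Finset.range M, ∑ j ∈ Finset.range M,
        ∫ y in ((j : ℝ) * (π / M))..((j : ℝ) * (π / M) + π / M),
          ∫ x in ((i : ℝ) * (π / M))..((i : ℝ) * (π / M) + π / M), g y x := by
  have hMr : (0 : ℝ) < M := by exact_mod_cast hM
  set a : ℕ → ℝ := fun l => (l : ℝ) * (π / M) with ha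
  have ha0 : a 0 = 0 := by simp [ha]
  have haM : a M = π := by simp only [ha]; field_simp
  have hasucc : ∀ l : ℕ, a (l + 1) = a l + π / M := by intro l; simp only [ha]; push_cast; ring
  have hgy : ∀ y, Continuous (g y) := fun y => hg.uncurry_left y
  -- inner decomposition
  have hinner : ∀ y, (∫ x in (0 : ℝ)..π, g y x) = ∑ i ∈ Finset.range M, ∫ x in (a i)..(a (i + 1)), g y x := by
    intro y
    rw [intervalIntegral.sum_integral_adjacent_intervals fun k _ => (hgy y).intervalIntegrable _ _, ha0, haM]
  have hFi : ∀ i : ℕ, Continuous fun y => ∫ x in (a i)..(a (i + 1)), g y x := fun i =>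
    intervalIntegral.continuous_parametric_intervalIntegral_of_continuous' hg _ _
  rw [intervalIntegral.integral_congr fun y _ => hinner y,
    intervalIntegral.integral_finsetSum fun i _ => (hFi i).intervalIntegrable _ _]
  refine Finset.sum_congr rfl fun i _ => ?_
  have hsplit := intervalIntegral.sum_integral_adjacent_intervals (μ := volume) (a := a) (n := M)
    fun k _ => (hFi i).intervalIntegrable (a k) (a (k + 1))
  rw [ha0, haM] at hsplit
  rw [← hsplit]
  refine Finset.sum_congr rfl fun j _ => ?_
  rw [hasucc, hasucc]

/-! ### §5 The second-order majorant: real form and integer adapter -/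

/-- **Second-order (trapezoid) majorant of the half-bathtub integral.** `M ≥ 1`, any `t'`, `ν`; cell data on `[0, π]`:
`cos(iπ/M) ≤ uᵢ` and `wᵢ ≤ cos((i+1)π/M)` (cosine box of cell `i`), `Wᵢ ≤ cos(iπ/M) + cos((i+1)π/M) ≤ Uᵢ` (vertex-sum box),
and a selector `κ` of cells such that `κ i j = true` only if the four corner values of `p + q + 4t'pq` on the box of cell
`(i, j)` are `≥ ν`. Then `∫_{-π}^{π}∫_{-π}^{π}(cos x + cos y + 4t' cos x cos y - ν)⁺ ≤ 4 Σ_{i,j<M} bᵢⱼ` with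
`bᵢⱼ = h²(max₄(2P + 2Q + 4t'PQ)/4 - ν) + (1 + 4|t'|)h⁴/6` on selected cells (`P ∈ {Wᵢ, Uᵢ}`, `Q ∈ {Wⱼ, Uⱼ}`; `h = π/M`)
and `bᵢⱼ = h²·max₄⁺(p + q + 4t'pq - ν)` (`p ∈ {wᵢ, uᵢ}`, `q ∈ {wⱼ, uⱼ}`) on the others.
[cite: HazraVermaRanderia2019, eqs. (2)-(6)] [cite: DavisRabinowitz1984, §2.1] -/
theorem halfBathtubIntegral_le_trapezoidSum (t' ν : ℝ) {M : ℕ} (hM : 0 < M) (u w U W : ℕ → ℝ)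
    (κ : ℕ → ℕ → Bool)
    (hu : ∀ i < M, Real.cos ((i : ℝ) * (π / M)) ≤ u i)
    (hw : ∀ i < M, w i ≤ Real.cos ((i : ℝ) * (π / M) + π / M))
    (hU : ∀ i < M, Real.cos ((i : ℝ) * (π / M)) + Real.cos ((i : ℝ) * (π / M) + π / M) ≤ U i)
    (hW : ∀ i < M, W i ≤ Real.cos ((i : ℝ) * (π / M)) + Real.cos ((i : ℝ) * (π / M) + π / M))
    (hκ : ∀ i < M, ∀ j < M, κ i j = true →
      ν ≤ w i + w j + 4 * t' * (w i * w j) ∧ ν ≤ w i + u j + 4 * t' * (w i * u j) ∧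
      ν ≤ u i + w j + 4 * t' * (u i * w j) ∧ ν ≤ u i + u j + 4 * t' * (u i * u j)) :
    (∫ y in (-π)..π, ∫ x in (-π)..π,
        max (Real.cos x + Real.cos y + 4 * t' * (Real.cos x * Real.cos y) - ν) 0) ≤
      4 * ∑ i ∈ Finset.range M, ∑ j ∈ Finset.range M,
        (if κ i j then
          (π / M) ^ 2 * (max (max (2 * W i + 2 * W j + 4 * t' * (W i * W j)) (2 * W i + 2 * U j + 4 * t' * (W i * U j)))
            (max (2 * U i + 2 * W j + 4 * t' * (U i * W j)) (2 * U i + 2 * U j + 4 * t' * (U i * U j))) / 4 - ν) +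
            (1 + 4 * |t'|) * (π / M) ^ 4 / 6
        else
          (π / M) ^ 2 * max (max (max (w i + w j + 4 * t' * (w i * w j) - ν) (w i + u j + 4 * t' * (w i * u j) - ν))
            (max (u i + w j + 4 * t' * (u i * w j) - ν) (u i + u j + 4 * t' * (u i * u j) - ν))) 0) := by
  have hMr : (0 : ℝ) < M := by exact_mod_cast hM
  have hh : 0 ≤ π / M := by positivity
  have hgc : Continuous (Function.uncurry fun y x : ℝ =>
      max (Real.cos x + Real.cos y + 4 * t' * (Real.cos x * Real.cos y) - ν) 0) := by
    rw [Function.uncurry_def]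
    fun_prop
  rw [integral_sq_eq_four_mul _ hgc (fun y x => by simp only [Real.cos_neg]) (fun y x => by simp only [Real.cos_neg]),
    integral_sq_eq_sum_cells _ hgc hM]
  refine mul_le_mul_of_nonneg_left (Finset.sum_le_sum fun i hi => Finset.sum_le_sum fun j hj => ?_) (by norm_num)
  rw [Finset.mem_range] at hi hj
  have hA : ∀ x ∈ Icc ((i : ℝ) * (π / M)) ((i : ℝ) * (π / M) + π / M), w i ≤ Real.cos x ∧ Real.cos x ≤ u i :=
    fun x hx => ⟨(hw i hi).trans (cos_mem_cell hM hi hx.1 hx.2).1, (cos_mem_cell hM hi hx.1 hx.2).2.trans (hu i hi)⟩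
  have hB : ∀ y ∈ Icc ((j : ℝ) * (π / M)) ((j : ℝ) * (π / M) + π / M), w j ≤ Real.cos y ∧ Real.cos y ≤ u j :=
    fun y hy => ⟨(hw j hj).trans (cos_mem_cell hM hj hy.1 hy.2).1, (cos_mem_cell hM hj hy.1 hy.2).2.trans (hu j hj)⟩
  cases hκij : κ i j
  · simp only [Bool.false_eq_true, ↓reduceIte]
    exact cell_le_corner t' ν hh hA hB
  · simp only [↓reduceIte]
    obtain ⟨h₁, h₂, h₃, h₄⟩ := hκ i hi j hj hκij
    exact cell_le_trapezoid t' ν hh hA hB h₁ h₂ h₃ h₄ (hW i hi) (hU i hi) (hW j hj) (hU j hj)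

/-- A `List.map`-sum over a list of integer quadruples as a `Finset.range` sum over `List.getD`. [folklore] -/
private theorem list_sum_map_eq_sum_range_getD_quad (P : List (ℤ × ℤ × ℤ × ℤ)) (h : ℤ × ℤ × ℤ × ℤ → ℤ) :
    (P.map h).sum = ∑ i ∈ Finset.range P.length, h (P.getD i (0, 0, 0, 0)) := by
  induction P with
  | nil => simp
  | cons x t ih =>
    rw [List.map_cons, List.sum_cons, List.length_cons, Finset.sum_range_succ', ih]
    simp only [List.getD_cons_succ, List.getD_cons_zero]
    ring

/-- **Kernel upper bounds on `B(t', ν)` from an integer trapezoid table** (second-order twin of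
`halfBathtub_le_of_cornerPairTable`; all arithmetic in `ℤ`): `t' = a/b`, `ν = c/E`, and a list `T` of `M ≥ 1` integer
quadruples `(Uᵢ, Wᵢ, U⁺ᵢ, W⁺ᵢ)` with `Uᵢ/D ≥ cos(iπ/M)` (the quarter-angle table check), `Wᵢ = -U_{M-1-i}` (the reflected
lower bound at the cell's right vertex), `U⁺ᵢ = Uᵢ + Uᵢ₊₁` (`U_M := -D`) and `W⁺ᵢ = Wᵢ₋₁ + Wᵢ` (`W₋₁ := D`) — four decidable
checks on `T`. THE CELL TERM (scale `K = D²bE`, times `4`): with the corner values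
`φ(p, q) = (p + q)DbE + 4apqE - cD²b = K·(p/D + q/D + 4t'(p/D)(q/D) - ν)` of the cell box `p ∈ {Wᵢ, Uᵢ}`, `q ∈ {Wⱼ, Uⱼ}` and
the vertex-sum values `ψ(P, Q) = (2P + 2Q)DbE + 4aPQE - 4cD²b`, `P ∈ {W⁺ᵢ, U⁺ᵢ}`, `Q ∈ {W⁺ⱼ, U⁺ⱼ}`: if the four `φ ≥ 0`
(interior cell) the term is `max₄ ψ + 4r` (`r` dominating the trapezoid remainder: `D²bE(b + 4|a|)·9.8697 ≤ 6rbM²`, i.e.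
`r ≥ K(1 + 4|t'|)π²/(6M²)`), otherwise `4·max₄⁺ φ`. If the double cell sum is `≤ W` and `W ≤ 4q·M²D²bE`, then
`(4π²)⁻¹∫∫(cos x + cos y + 4t' cos x cos y - ν)⁺ ≤ q` (`halfBathtubIntegral_le_trapezoidSum`).
[cite: HazraVermaRanderia2019, eqs. (2)-(6)] [cite: DavisRabinowitz1984, §2.1] -/
theorem halfBathtub_le_of_trapezoidTable (a b c E D r W : ℤ) (M : ℕ) (q : ℚ)
    (T : List (ℤ × ℤ × ℤ × ℤ)) (hTM : T.length = M) (hM : 0 < M) (hb : 0 < b) (hE : 0 < E) (hD : 0 < D)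
    (htab : ∀ i : ℕ, i < M → 2 * (2 * (1 - 2 * ((i : ℚ) * (392699 / 125000) / (8 * (M : ℚ)) -
      ((i : ℚ) * (392699 / 125000) / (8 * (M : ℚ))) ^ 3 / 6) ^ 2) ^ 2 - 1) ^ 2 - 1 ≤
      ((T.getD i (0, 0, 0, 0)).1 : ℚ) / (D : ℚ))
    (hrefl : ∀ i : ℕ, i < M → (T.getD i (0, 0, 0, 0)).2.1 = -(T.getD (M - 1 - i) (0, 0, 0, 0)).1)
    (hsumU : ∀ i : ℕ, i < M → (T.getD i (0, 0, 0, 0)).2.2.1 =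
      (T.getD i (0, 0, 0, 0)).1 + (if i + 1 < M then (T.getD (i + 1) (0, 0, 0, 0)).1 else -D))
    (hsumW : ∀ i : ℕ, i < M → (T.getD i (0, 0, 0, 0)).2.2.2 =
      (if i = 0 then D else (T.getD (i - 1) (0, 0, 0, 0)).2.1) + (T.getD i (0, 0, 0, 0)).2.1)
    (hr : D ^ 2 * b * E * (b + 4 * |a|) * 98697 ≤ r * (6 * (M : ℤ) ^ 2 * b * 10000))
    (hW : (T.map fun x => (T.map fun y =>
        (if 0 ≤ (x.2.1 + y.2.1) * D * b * E + 4 * a * x.2.1 * y.2.1 * E - c * D ^ 2 * b ∧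
            0 ≤ (x.2.1 + y.1) * D * b * E + 4 * a * x.2.1 * y.1 * E - c * D ^ 2 * b ∧
            0 ≤ (x.1 + y.2.1) * D * b * E + 4 * a * x.1 * y.2.1 * E - c * D ^ 2 * b ∧
            0 ≤ (x.1 + y.1) * D * b * E + 4 * a * x.1 * y.1 * E - c * D ^ 2 * b then
          max (max ((2 * x.2.2.2 + 2 * y.2.2.2) * D * b * E + 4 * a * x.2.2.2 * y.2.2.2 * E - 4 * c * D ^ 2 * b)
              ((2 * x.2.2.2 + 2 * y.2.2.1) * D * b * E + 4 * a * x.2.2.2 * y.2.2.1 * E - 4 * c * D ^ 2 * b))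
            (max ((2 * x.2.2.1 + 2 * y.2.2.2) * D * b * E + 4 * a * x.2.2.1 * y.2.2.2 * E - 4 * c * D ^ 2 * b)
              ((2 * x.2.2.1 + 2 * y.2.2.1) * D * b * E + 4 * a * x.2.2.1 * y.2.2.1 * E - 4 * c * D ^ 2 * b)) + 4 * r
         else
          4 * max (max (max ((x.2.1 + y.2.1) * D * b * E + 4 * a * x.2.1 * y.2.1 * E - c * D ^ 2 * b)
              ((x.2.1 + y.1) * D * b * E + 4 * a * x.2.1 * y.1 * E - c * D ^ 2 * b))
            (max ((x.1 + y.2.1) * D * b * E + 4 * a * x.1 * y.2.1 * E - c * D ^ 2 * b)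
              ((x.1 + y.1) * D * b * E + 4 * a * x.1 * y.1 * E - c * D ^ 2 * b))) 0)).sum).sum ≤ W)
    (hq : (W : ℚ) ≤ q * (4 * (M : ℚ) ^ 2 * (D : ℚ) ^ 2 * b * E)) :
    (∫ y in (-π)..π, ∫ x in (-π)..π,
        max (Real.cos x + Real.cos y + 4 * ((a : ℝ) / b) * (Real.cos x * Real.cos y) - (c : ℝ) / E) 0) /
        (4 * π ^ 2) ≤ ((q : ℚ) : ℝ) := by
  -- name the cell term
  obtain ⟨cell, hcell⟩ : ∃ f : ℤ × ℤ × ℤ × ℤ → ℤ × ℤ × ℤ × ℤ → ℤ, ∀ x y : ℤ × ℤ × ℤ × ℤ, f x y =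
      (if 0 ≤ (x.2.1 + y.2.1) * D * b * E + 4 * a * x.2.1 * y.2.1 * E - c * D ^ 2 * b ∧
          0 ≤ (x.2.1 + y.1) * D * b * E + 4 * a * x.2.1 * y.1 * E - c * D ^ 2 * b ∧
          0 ≤ (x.1 + y.2.1) * D * b * E + 4 * a * x.1 * y.2.1 * E - c * D ^ 2 * b ∧
          0 ≤ (x.1 + y.1) * D * b * E + 4 * a * x.1 * y.1 * E - c * D ^ 2 * b then
        max (max ((2 * x.2.2.2 + 2 * y.2.2.2) * D * b * E + 4 * a * x.2.2.2 * y.2.2.2 * E - 4 * c * D ^ 2 * b)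
            ((2 * x.2.2.2 + 2 * y.2.2.1) * D * b * E + 4 * a * x.2.2.2 * y.2.2.1 * E - 4 * c * D ^ 2 * b))
          (max ((2 * x.2.2.1 + 2 * y.2.2.2) * D * b * E + 4 * a * x.2.2.1 * y.2.2.2 * E - 4 * c * D ^ 2 * b)
            ((2 * x.2.2.1 + 2 * y.2.2.1) * D * b * E + 4 * a * x.2.2.1 * y.2.2.1 * E - 4 * c * D ^ 2 * b)) + 4 * r
       else
        4 * max (max (max ((x.2.1 + y.2.1) * D * b * E + 4 * a * x.2.1 * y.2.1 * E - c * D ^ 2 * b)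
            ((x.2.1 + y.1) * D * b * E + 4 * a * x.2.1 * y.1 * E - c * D ^ 2 * b))
          (max ((x.1 + y.2.1) * D * b * E + 4 * a * x.1 * y.2.1 * E - c * D ^ 2 * b)
            ((x.1 + y.1) * D * b * E + 4 * a * x.1 * y.1 * E - c * D ^ 2 * b))) 0) :=
    ⟨_, fun _ _ => rfl⟩
  have hW' : (T.map fun x => (T.map fun y => cell x y).sum).sum ≤ W := by
    simpa only [hcell] using hW
  clear hW
  subst hTM
  set M := T.length with hMdef
  have hMr : (0 : ℝ) < M := by exact_mod_cast hM
  have hbr : (0 : ℝ) < b := by exact_mod_cast hb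
  have hEr : (0 : ℝ) < E := by exact_mod_cast hE
  have hDr : (0 : ℝ) < D := by exact_mod_cast hD
  have hDne : (D : ℝ) ≠ 0 := hDr.ne'
  have hbne : (b : ℝ) ≠ 0 := hbr.ne'
  have hEne : (E : ℝ) ≠ 0 := hEr.ne'
  have hMne : (M : ℝ) ≠ 0 := hMr.ne'
  have hπ := Real.pi_pos
  have hπ2 : (0 : ℝ) < 4 * π ^ 2 := by positivity
  set K : ℝ := (D : ℝ) ^ 2 * b * E with hKdef
  have hK : 0 < K := by positivity
  set t : ℝ := (a : ℝ) / b with htdef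
  set ν : ℝ := (c : ℝ) / E with hνdef
  -- the four real tables (cell upper / cell lower / vertex-sum upper / vertex-sum lower)
  set u : ℕ → ℝ := fun i => (((T.getD i (0, 0, 0, 0)).1 : ℤ) : ℝ) / D with hudef
  set w : ℕ → ℝ := fun i => (((T.getD i (0, 0, 0, 0)).2.1 : ℤ) : ℝ) / D with hwdef
  set U : ℕ → ℝ := fun i => (((T.getD i (0, 0, 0, 0)).2.2.1 : ℤ) : ℝ) / D with hUdef
  set V : ℕ → ℝ := fun i => (((T.getD i (0, 0, 0, 0)).2.2.2 : ℤ) : ℝ) / D with hVdef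
  -- §a the cosine bounds
  have hcos := cos_table_of_quarterAngle_checkT hM (fun i => ((T.getD i (0, 0, 0, 0)).1 : ℚ) / D)
    fun i hi => htab i hi
  have hu' : ∀ i < M, Real.cos (i * π / M) ≤ u i := fun i hi => by
    have h := hcos i hi
    have e : (((((T.getD i (0, 0, 0, 0)).1 : ℤ) : ℚ) / (D : ℚ) : ℚ) : ℝ) = u i := by
      simp only [hudef]
      push_cast
      rfl
    rwa [e] at h
  have hu : ∀ i < M, Real.cos ((i : ℝ) * (π / M)) ≤ u i := fun i hi => by
    rw [← mul_div_assoc]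
    exact hu' i hi
  have hw : ∀ i < M, w i ≤ Real.cos ((i : ℝ) * (π / M) + π / M) := fun i hi => by
    have hidx : M - 1 - i < M := by omega
    have h1 := hu' (M - 1 - i) hidx
    have e1 : ((M - 1 - i : ℕ) : ℝ) * π / M = π - ((i : ℝ) * (π / M) + π / M) := by
      rw [Nat.cast_sub (by omega), Nat.cast_sub (by omega)]
      push_cast
      field_simp
      ring
    rw [e1, Real.cos_pi_sub] at h1
    have e2 : w i = -u (M - 1 - i) := by
      simp only [hwdef, hudef]
      rw [hrefl i hi]
      push_cast
      ring
    rw [e2]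
    linarith
  have hU : ∀ i < M, Real.cos ((i : ℝ) * (π / M)) + Real.cos ((i : ℝ) * (π / M) + π / M) ≤ U i := fun i hi => by
    have h1 : Real.cos ((i : ℝ) * (π / M)) ≤ u i := hu i hi
    have h2 : Real.cos ((i : ℝ) * (π / M) + π / M) ≤ (if i + 1 < M then u (i + 1) else -1) := by
      split_ifs with h
      · have h3 := hu (i + 1) h
        push_cast at h3
        rw [show ((i : ℝ) + 1) * (π / M) = (i : ℝ) * (π / M) + π / M by ring] at h3
        exact h3
      · have hi1 : ((i : ℝ) + 1) = M := by exact_mod_cast (show i + 1 = M by omega)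
        have e : (i : ℝ) * (π / M) + π / M = π := by
          rw [show (i : ℝ) * (π / M) + π / M = ((i : ℝ) + 1) * (π / M) by ring, hi1]
          field_simp
        rw [e, Real.cos_pi]
    have e3 : U i = u i + (if i + 1 < M then u (i + 1) else -1) := by
      simp only [hUdef, hudef]
      rw [hsumU i hi]
      split_ifs <;> push_cast <;> field_simp
    rw [e3]
    exact add_le_add h1 h2
  have hV : ∀ i < M, V i ≤ Real.cos ((i : ℝ) * (π / M)) + Real.cos ((i : ℝ) * (π / M) + π / M) := fun i hi => by
    have h2 : w i ≤ Real.cos ((i : ℝ) * (π / M) + π / M) := hw i hi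
    have h1 : (if i = 0 then (1 : ℝ) else w (i - 1)) ≤ Real.cos ((i : ℝ) * (π / M)) := by
      split_ifs with h
      · subst h
        simp
      · have h3 := hw (i - 1) (by omega)
        have e : ((i - 1 : ℕ) : ℝ) * (π / M) + π / M = (i : ℝ) * (π / M) := by
          rw [Nat.cast_sub (by omega)]
          push_cast
          ring
        rwa [e] at h3
    have e3 : V i = (if i = 0 then (1 : ℝ) else w (i - 1)) + w i := by
      simp only [hVdef, hwdef]
      rw [hsumW i hi]
      split_ifs <;> push_cast <;> field_simp
    rw [e3]
    exact add_le_add h1 h2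
  -- §b integer ↔ real identities for the corner and vertex-sum values
  have hφ : ∀ p s : ℤ, ((p : ℤ) : ℝ) / D + ((s : ℤ) : ℝ) / D + 4 * t * (((p : ℤ) : ℝ) / D * (((s : ℤ) : ℝ) / D)) - ν =
      (((p + s) * D * b * E + 4 * a * p * s * E - c * D ^ 2 * b : ℤ) : ℝ) / K := by
    intro p s
    simp only [hKdef, htdef, hνdef]
    rw [eq_div_iff hK.ne']
    push_cast
    field_simp
    ring
  have hψ : ∀ p s : ℤ, 2 * (((p : ℤ) : ℝ) / D) + 2 * (((s : ℤ) : ℝ) / D) + 4 * t * (((p : ℤ) : ℝ) / D * (((s : ℤ) : ℝ) / D)) =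
      ((((2 * p + 2 * s) * D * b * E + 4 * a * p * s * E - 4 * c * D ^ 2 * b : ℤ) : ℝ)) / K + 4 * ν := by
    intro p s
    simp only [hKdef, htdef, hνdef]
    rw [div_add' _ _ _ hK.ne', eq_div_iff hK.ne']
    push_cast
    field_simp
    ring
  -- §c the selector of interior cells and its soundness
  set κ : ℕ → ℕ → Bool := fun i j => decide
    (0 ≤ ((T.getD i (0, 0, 0, 0)).2.1 + (T.getD j (0, 0, 0, 0)).2.1) * D * b * E +
        4 * a * (T.getD i (0, 0, 0, 0)).2.1 * (T.getD j (0, 0, 0, 0)).2.1 * E - c * D ^ 2 * b ∧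
      0 ≤ ((T.getD i (0, 0, 0, 0)).2.1 + (T.getD j (0, 0, 0, 0)).1) * D * b * E +
        4 * a * (T.getD i (0, 0, 0, 0)).2.1 * (T.getD j (0, 0, 0, 0)).1 * E - c * D ^ 2 * b ∧
      0 ≤ ((T.getD i (0, 0, 0, 0)).1 + (T.getD j (0, 0, 0, 0)).2.1) * D * b * E +
        4 * a * (T.getD i (0, 0, 0, 0)).1 * (T.getD j (0, 0, 0, 0)).2.1 * E - c * D ^ 2 * b ∧
      0 ≤ ((T.getD i (0, 0, 0, 0)).1 + (T.getD j (0, 0, 0, 0)).1) * D * b * E +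
        4 * a * (T.getD i (0, 0, 0, 0)).1 * (T.getD j (0, 0, 0, 0)).1 * E - c * D ^ 2 * b) with hκdef
  have hge_of_int : ∀ p s : ℤ, 0 ≤ (p + s) * D * b * E + 4 * a * p * s * E - c * D ^ 2 * b →
      ν ≤ ((p : ℤ) : ℝ) / D + ((s : ℤ) : ℝ) / D + 4 * t * (((p : ℤ) : ℝ) / D * (((s : ℤ) : ℝ) / D)) := by
    intro p s h
    have h1 : (0 : ℝ) ≤ (((p + s) * D * b * E + 4 * a * p * s * E - c * D ^ 2 * b : ℤ) : ℝ) / K :=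
      div_nonneg (by exact_mod_cast h) hK.le
    rw [← hφ] at h1
    linarith
  have hκ : ∀ i < M, ∀ j < M, κ i j = true →
      ν ≤ w i + w j + 4 * t * (w i * w j) ∧ ν ≤ w i + u j + 4 * t * (w i * u j) ∧
      ν ≤ u i + w j + 4 * t * (u i * w j) ∧ ν ≤ u i + u j + 4 * t * (u i * u j) := by
    intro i _ j _ hk
    simp only [hκdef, decide_eq_true_eq] at hk
    obtain ⟨k1, k2, k3, k4⟩ := hk
    exact ⟨hge_of_int _ _ k1, hge_of_int _ _ k2, hge_of_int _ _ k3, hge_of_int _ _ k4⟩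
  -- §d the real majorant
  have hmain := halfBathtubIntegral_le_trapezoidSum t ν hM u w U V κ hu hw hU hV hκ
  -- §e the remainder constant
  have hrem : (1 + 4 * |t|) * (π / M) ^ 4 / 6 ≤ (π / M) ^ 2 / (4 * K) * (((4 * r : ℤ) : ℝ)) := by
    have hπ4 : π ^ 2 ≤ 98697 / 10000 := by
      have h4 := Real.pi_lt_d4
      nlinarith [h4, hπ]
    have hrR : (((D ^ 2 * b * E * (b + 4 * |a|) * 98697 : ℤ) : ℝ)) ≤ ((r * (6 * (M : ℤ) ^ 2 * b * 10000) : ℤ) : ℝ) := by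
      exact_mod_cast hr
    push_cast at hrR
    have habs : |t| = |(a : ℝ)| / b := by
      simp only [htdef, abs_div, abs_of_pos hbr]
    -- `K (1 + 4|t|) π² / (6 M²) ≤ r`
    have h1 : K * (1 + 4 * |t|) * (98697 / 10000) ≤ 6 * (M : ℝ) ^ 2 * r := by
      rw [habs]
      simp only [hKdef]
      rw [show (D : ℝ) ^ 2 * b * E * (1 + 4 * (|(a : ℝ)| / b)) * (98697 / 10000) =
        ((D : ℝ) ^ 2 * b * E * (b + 4 * |(a : ℝ)|) * 98697) / (b * 10000) by field_simp]
      rw [div_le_iff₀ (by positivity)]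
      nlinarith [hrR]
    have h2 : K * (1 + 4 * |t|) * π ^ 2 ≤ 6 * (M : ℝ) ^ 2 * r := by
      have h3 : 0 ≤ K * (1 + 4 * |t|) := by positivity
      nlinarith [mul_le_mul_of_nonneg_left hπ4 h3]
    rw [show (1 + 4 * |t|) * (π / M) ^ 4 / 6 = ((π / M) ^ 2 / (4 * K)) * (4 * (K * (1 + 4 * |t|) * π ^ 2) / (6 * M ^ 2)) by
      field_simp]
    refine mul_le_mul_of_nonneg_left ?_ (by positivity)
    rw [div_le_iff₀ (by positivity)]
    push_cast
    nlinarith [h2]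
  -- §f term by term: the real cell bound is `(π/M)²/(4K) ×` the integer cell term
  have hterm : ∀ i ∈ Finset.range M, ∀ j ∈ Finset.range M,
      (if κ i j then
          (π / M) ^ 2 * (max (max (2 * V i + 2 * V j + 4 * t * (V i * V j)) (2 * V i + 2 * U j + 4 * t * (V i * U j)))
            (max (2 * U i + 2 * V j + 4 * t * (U i * V j)) (2 * U i + 2 * U j + 4 * t * (U i * U j))) / 4 - ν) +
            (1 + 4 * |t|) * (π / M) ^ 4 / 6
        else
          (π / M) ^ 2 * max (max (max (w i + w j + 4 * t * (w i * w j) - ν) (w i + u j + 4 * t * (w i * u j) - ν))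
            (max (u i + w j + 4 * t * (u i * w j) - ν) (u i + u j + 4 * t * (u i * u j) - ν))) 0) ≤
      (π / M) ^ 2 / (4 * K) *
        ((cell (T.getD i (0, 0, 0, 0)) (T.getD j (0, 0, 0, 0)) : ℤ) : ℝ) := by
    intro i _ j _
    have hpos : 0 ≤ (π / M) ^ 2 / (4 * K) := by positivity
    by_cases hc : (0 ≤ ((T.getD i (0, 0, 0, 0)).2.1 + (T.getD j (0, 0, 0, 0)).2.1) * D * b * E +
        4 * a * (T.getD i (0, 0, 0, 0)).2.1 * (T.getD j (0, 0, 0, 0)).2.1 * E - c * D ^ 2 * b ∧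
      0 ≤ ((T.getD i (0, 0, 0, 0)).2.1 + (T.getD j (0, 0, 0, 0)).1) * D * b * E +
        4 * a * (T.getD i (0, 0, 0, 0)).2.1 * (T.getD j (0, 0, 0, 0)).1 * E - c * D ^ 2 * b ∧
      0 ≤ ((T.getD i (0, 0, 0, 0)).1 + (T.getD j (0, 0, 0, 0)).2.1) * D * b * E +
        4 * a * (T.getD i (0, 0, 0, 0)).1 * (T.getD j (0, 0, 0, 0)).2.1 * E - c * D ^ 2 * b ∧
      0 ≤ ((T.getD i (0, 0, 0, 0)).1 + (T.getD j (0, 0, 0, 0)).1) * D * b * E +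
        4 * a * (T.getD i (0, 0, 0, 0)).1 * (T.getD j (0, 0, 0, 0)).1 * E - c * D ^ 2 * b)
    · -- interior cell: trapezoid term
      have hk : κ i j = true := by simp only [hκdef, hc, and_self, decide_true]
      rw [if_pos hk]
      rw [hcell, if_pos hc]
      push_cast
      simp only [hVdef, hUdef]
      rw [hψ, hψ, hψ, hψ, max_add_add_right, max_add_add_right, max_add_add_right,
        max_div_div_right hK.le, max_div_div_right hK.le, max_div_div_right hK.le]
      have e : ∀ X : ℝ, (π / M) ^ 2 * ((X / K + 4 * ν) / 4 - ν) = (π / M) ^ 2 / (4 * K) * X := by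
        intro X
        field_simp
        ring
      rw [e, mul_add]
      push_cast at hrem ⊢
      linarith [hrem]
    · -- other cell: four-corner term
      have hk : ¬ (κ i j = true) := by simp only [hκdef, hc, decide_false, Bool.false_eq_true, not_false_eq_true]
      rw [if_neg hk]
      rw [hcell, if_neg hc]
      push_cast
      simp only [hwdef, hudef]
      rw [hφ, hφ, hφ, hφ, max_div_div_right hK.le, max_div_div_right hK.le, max_div_div_right hK.le,
        show ∀ z : ℝ, max (z / K) 0 = max (z / K) (0 / K) from fun z => by rw [zero_div],
        max_div_div_right hK.le]
      push_cast
      have e : ∀ X : ℝ, (π / M) ^ 2 * (X / K) = (π / M) ^ 2 / (4 * K) * (4 * X) := fun X => by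
        field_simp
      exact le_of_eq (e _)
  -- §g summing up
  have hlistZ : ((T.map fun x => (T.map fun y => cell x y).sum).sum : ℤ) =
      ∑ i ∈ Finset.range M, ∑ j ∈ Finset.range M,
        cell (T.getD i (0, 0, 0, 0)) (T.getD j (0, 0, 0, 0)) := by
    rw [list_sum_map_eq_sum_range_getD_quad T]
    refine Finset.sum_congr rfl fun i _ => ?_
    rw [list_sum_map_eq_sum_range_getD_quad T]
  have hlist : (((T.map fun x => (T.map fun y => cell x y).sum).sum : ℤ) : ℝ) =
      ∑ i ∈ Finset.range M, ∑ j ∈ Finset.range M,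
        ((cell (T.getD i (0, 0, 0, 0)) (T.getD j (0, 0, 0, 0)) : ℤ) : ℝ) := by
    rw [hlistZ]
    push_cast
    rfl
  have hsum : (∑ i ∈ Finset.range M, ∑ j ∈ Finset.range M,
      (if κ i j then
          (π / M) ^ 2 * (max (max (2 * V i + 2 * V j + 4 * t * (V i * V j)) (2 * V i + 2 * U j + 4 * t * (V i * U j)))
            (max (2 * U i + 2 * V j + 4 * t * (U i * V j)) (2 * U i + 2 * U j + 4 * t * (U i * U j))) / 4 - ν) +
            (1 + 4 * |t|) * (π / M) ^ 4 / 6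
        else
          (π / M) ^ 2 * max (max (max (w i + w j + 4 * t * (w i * w j) - ν) (w i + u j + 4 * t * (w i * u j) - ν))
            (max (u i + w j + 4 * t * (u i * w j) - ν) (u i + u j + 4 * t * (u i * u j) - ν))) 0)) ≤
      (π / M) ^ 2 / (4 * K) * (W : ℝ) := by
    calc _ ≤ ∑ i ∈ Finset.range M, ∑ j ∈ Finset.range M, (π / M) ^ 2 / (4 * K) *
          ((cell (T.getD i (0, 0, 0, 0)) (T.getD j (0, 0, 0, 0)) : ℤ) : ℝ) :=
          Finset.sum_le_sum fun i hi => Finset.sum_le_sum fun j hj => hterm i hi j hj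
      _ = (π / M) ^ 2 / (4 * K) * (((T.map fun x => (T.map fun y => cell x y).sum).sum : ℤ) : ℝ) := by
          rw [hlist, Finset.mul_sum]
          refine Finset.sum_congr rfl fun i _ => ?_
          rw [Finset.mul_sum]
      _ ≤ (π / M) ^ 2 / (4 * K) * (W : ℝ) := by
          refine mul_le_mul_of_nonneg_left ?_ (by positivity)
          exact_mod_cast hW'
  have hqR : (W : ℝ) ≤ ((q : ℚ) : ℝ) * (4 * (M : ℝ) ^ 2 * K) := by
    have h := (Rat.cast_le (K := ℝ)).2 hq
    push_cast at h
    simp only [hKdef]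
    linarith [h]
  rw [div_le_iff₀ hπ2]
  calc (∫ y in (-π)..π, ∫ x in (-π)..π,
        max (Real.cos x + Real.cos y + 4 * t * (Real.cos x * Real.cos y) - ν) 0)
      ≤ 4 * ((π / M) ^ 2 / (4 * K) * (W : ℝ)) := hmain.trans (by linarith [hsum])
    _ ≤ 4 * ((π / M) ^ 2 / (4 * K) * (((q : ℚ) : ℝ) * (4 * (M : ℝ) ^ 2 * K))) := by
        gcongr
    _ = ((q : ℚ) : ℝ) * (4 * π ^ 2) := by
        field_simp

end HalfBathtubTrapezoidBound

end Literature.MathematicalPhysics.QuantumLattice
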